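import Summits.BirchSwinnertonDyer.BirchSwinnertonDyer.Theorems.GoldfeldAllTwistsTwoConverseTwinSplitTwistSelmerPOne
import Summits.BirchSwinnertonDyer.BirchSwinnertonDyer.Theorems.GoldfeldAllTwistsTwoConverseTwinQuarterTracePartnerPAlphaHeight
import HarnessLib

set_option linter.dupNamespace false -- namespace `…BirchSwinnertonDyer.BirchSwinnertonDyer…` is the cell's (D-0017 nested layout)
set_option autoImplicit false

/-!
# Cell C7A partner `49a1^{(p)}` at `p ≡ 1 (mod 8)`, type α, file D2-split: the PARTNER `L`-VALUE **`ord₂ L^{alg}(49a1^{(p)}, 1) = 1`**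
# (`L(W′,1) = q·Ω_∞(W′)`, `q ≠ 0`, `ord₂ q = 1`) and its `√p`-period form — the χ_p-α / χ_e-α package input on C7A

Cell `bsd-goldfeld`, seat `bsd-goldfeld-s1p-c3x` (gen 13); planner RULING (ccclx) «OBJECT C7A BY THE χ_Z CHANNEL», tranche T4, file D2-split (memo
`HOME/C7A-CHIZ-CHANNEL.md` §2: one of the two ESSENTIAL `p ≡ 5 (8)` inputs of the α cone, re-proved at `p ≡ 1 (8)`). `--supports
stmt-BirchSwinnertonDyer-20044` as a HELPER. Theses-free; theorems only; no definition, no new fact, no `sorry`. BINDERS BY NAME (the cell's standing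
allow-list): `hBT = burungaleTian_analyticRank_eq_zero_of_selmerCorank_eq_zero_of_hasCM`, `hBF = bsdTriple_of_hasCM_of_L_one_ne_zero`,
`hnew = exists_isNewformOf`. FRONTIER-grade: a twist-density-ZERO sub-family modulo named print; never distance-to-summit.

THE ARGUMENT = U3b (`…TwinSplitTwistLValue` §1, `ℓ ≡ 5 (8)`) and `lValue_posTwist_mul_sqrt_of_alpha` (`…TwinQuarterTracePartnerPAlphaHeight` §1) VERBATIM
on the D1-split descent (`rank = 0 ∧ Ш[2] = 0` for `σ(p) = −1` at `p ≡ 1 (8)`): `hBT` ⇒ `r_an = 0` (`analyticRank_eq_zero_posTwist_of_symbol_neg_pOne`);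
`hBF` ⇒ `L(1)/Ω = #Ш·Tam/#W′(ℚ)²` with `#Ш` ODD, `#tors = 2`, `Tam = 8` ⇒ `q = 2#Ш` (`exists_LAlg_posTwist_of_symbol_neg_pOne`); the type-α form with the
period law `√p·Ω(W_p) = Ω(49a1)` (`lValue_posTwist_mul_sqrt_of_alpha_pOne`). Numerics (kit j317613): `r_an(49a1^{(p)}) = 0`, ellrank `[0,0,0]` on 47/47 C7A rows.
HONEST FRAMING: one partner `L`-value modulo named print; items 19140 / 20044 unchanged; BSD is not proved by any of this.

References: [BurungaleFlach2024] Thm 1.1, Cor. 2; [BurungaleTian2026] Thm 1.1; [CoatesLiTianZhai2015] Thm 4.4 (shape), §5 Prop. 5.9; [Pal2012] Thm 3.2.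
-/

noncomputable section

open scoped Classical

open NumberField WeierstrassCurve Field Literature.NumberTheory.EllipticCurves
  Literature.NumberTheory.EllipticCurves.ModularForms
  Literature.NumberTheory.EllipticCurves.CaiShuTian2014
  Literature.NumberTheory.GaloisRepresentations
  Summit.BirchSwinnertonDyer.Rank1Residual.P2

namespace Summit.BirchSwinnertonDyer.BirchSwinnertonDyer.Theorems.GoldfeldGoodTwists

/-! ## §1 The partner `L`-value at `ℓ ≡ 1 (mod 8)`, `σ(ℓ) = −1` -/

section PartnerLValuePOne

variable {l : ℕ} [Fact l.Prime]

/-- **`σ(ℓ) = −1`, `ℓ ≡ 1 (8)` ⇒ `L(49a1^{(ℓ)}, 1) ≠ 0`** (analytic rank `0`) for every model `W` of `49a1^{(ℓ)}`, granted Burungale–Tian's rank-zero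
`2`-converse for CM curves (`hBT`): `rank = 0 ∧ Ш[2] = 0` (D1-split) ⇒ `corank Sel_{2^∞} = 0`. [cite: BurungaleTian2026, Thm. 1.1]
[cite: SilvermanAEC2009, Thm. X.4.2(a) and Prop. X.4.9] -/
theorem analyticRank_eq_zero_posTwist_of_symbol_neg_pOne
    (hBT : burungaleTian_analyticRank_eq_zero_of_selmerCorank_eq_zero_of_hasCM)
    (hl8 : l % 8 = 1) (hl7 : legendreSym l (-7) = 1) (hσ : ∀ s : ZMod l, s ^ 2 = -7 → ¬ IsSquare (2 * (s - 21)))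
    (W : WeierstrassCurve ℚ) [W.IsElliptic] (C : VariableChange ℚ) (hC : C • W = cm7.quadraticTwist ((l : ℤ) : ℚ)) :
    W.analyticRank = 0 :=
  analyticRank_eq_zero_of_rank_eq_zero_of_sha_two hBT W
    (minimalModel_quadraticTwist_cm7 (by exact_mod_cast (Fact.out : l.Prime).ne_zero) W C hC).2.1
    (rank_eq_zero_and_sha_two_posTwist_of_symbol_neg_pOne hl8 hl7 hσ W C hC)

/-- **`#Ш(W')` is ODD** for every globally minimal (indeed every) model `W'` of `49a1^{(ℓ)}` with `σ(ℓ) = −1` once `Ш(W')`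
is finite (`ℓ ≡ 1 (mod 8)`): `Ш(W')[2] = 0` (UNCONDITIONAL complete `2`-descent, D1-split) so the `2`-primary part is trivial.
[cite: SilvermanAEC2009, Thm. X.4.2(a) and Prop. X.4.9] -/
theorem padicValNat_two_shaOrder_posTwist_of_symbol_neg_pOne (hl8 : l % 8 = 1) (hl7 : legendreSym l (-7) = 1)
    (hσ : ∀ s : ZMod l, s ^ 2 = -7 → ¬ IsSquare (2 * (s - 21)))
    (W' : WeierstrassCurve ℚ) [W'.IsElliptic] (C : VariableChange ℚ) (hC : C • W' = cm7.quadraticTwist ((l : ℤ) : ℚ))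
    [Finite W'.sha] : padicValNat 2 W'.shaOrder = 0 := by
  haveI : Fact (Nat.Prime 2) := ⟨Nat.prime_two⟩
  have h2 := (rank_eq_zero_and_sha_two_posTwist_of_symbol_neg_pOne hl8 hl7 hσ W' C hC).2
  have hbot := W'.primaryComponent_sha_eq_bot_of_forall h2
  have hcard : Nat.card (AddCommGroup.primaryComponent W'.sha 2) = 1 := by rw [hbot]; exact AddSubgroup.card_bot
  rw [WeierstrassCurve.shaOrder, ← padicValNat_card_addPrimaryComponent (A := W'.sha) 2, hcard, padicValNat_one_right]

/-- **THE PARTNER `L`-VALUE `ord₂ L^{alg}(49a1^{(ℓ)}, 1) = 1`** (split twin of Coates–Li–Tian–Zhai Thm 4.4 at `r = 1`):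
for a prime `ℓ ≡ 1 (mod 8)`, `(−7/ℓ) = +1`, with split symbol `σ(ℓ) = −1` (type α), and every GLOBALLY MINIMAL model `W'` of
`49a1^{(ℓ)}`: `L(W',1) = q·Ω_∞(W')`, `q ≠ 0`, `ord₂ q = 1` — granted Burungale–Tian (`hBT`: `r_an = 0` from
`corank Sel_{2^∞} = 0`), Burungale–Flach (`hBF`: `L(1)/Ω = #Ш·Tam/#tors²` for CM rank zero) and Modularity (`hnew`);
with `#Ш` odd, `#tors = 2`, `Tam = 8` (file U3a) so `q = 2#Ш`. [cite: BurungaleFlach2024, Thm. 1.1 and Cor. 2]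
[cite: BurungaleTian2026, Thm. 1.1] [cite: CoatesLiTianZhai2015, Thm. 4.4 (shape, case r = 1)] -/
theorem exists_LAlg_posTwist_of_symbol_neg_pOne
    (hBT : burungaleTian_analyticRank_eq_zero_of_selmerCorank_eq_zero_of_hasCM)
    (hBF : bsdTriple_of_hasCM_of_L_one_ne_zero) (hnew : exists_isNewformOf)
    (hl8 : l % 8 = 1) (hl7 : legendreSym l (-7) = 1) (hσ : ∀ s : ZMod l, s ^ 2 = -7 → ¬ IsSquare (2 * (s - 21)))
    (W' : WeierstrassCurve ℚ) [W'.IsElliptic] [W'.IsGloballyMinimal]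
    (hC : ∃ C : VariableChange ℚ, C • W' = cm7.quadraticTwist (l : ℚ)) :
    ∃ q : ℚ, W'.entireLFunction 1 = ((q * CoatesLiTianZhai2015.leastRealPeriod W' : ℝ) : ℂ) ∧ q ≠ 0 ∧
      padicValRat 2 q = 1 := by
  have hl : l.Prime := Fact.out
  have hl2 : l ≠ 2 := by rintro rfl; norm_num at hl8
  have hl4 : l % 4 = 1 := by omega
  obtain ⟨C, hC⟩ := hC
  have hC' : C • W' = cm7.quadraticTwist ((l : ℤ) : ℚ) := by rw [hC]; push_cast; rfl
  have hl0 : (l : ℚ) ≠ 0 := by exact_mod_cast hl.ne_zero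
  have hmod : hasEntireLFunction_rat := hasEntireLFunction_rat_of_exists_isNewformOf hnew
  haveI : Fact (Nat.Prime 2) := ⟨Nat.prime_two⟩
  ------------------------------------------------------------------ `r_an = 0`, `L(1) ≠ 0`, CM, `j`
  have hr0 : W'.analyticRank = 0 := analyticRank_eq_zero_posTwist_of_symbol_neg_pOne hBT hl8 hl7 hσ W' C hC'
  have hL : W'.entireLFunction 1 ≠ 0 := (W'.analyticRank_eq_zero_iff_holds (hmod W')).mp hr0
  obtain ⟨hj, hcm, -⟩ := minimalModel_quadraticTwist_cm7 (show ((l : ℤ)) ≠ 0 by exact_mod_cast hl.ne_zero) W' C hC'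
  ------------------------------------------------------------------ Burungale–Flach: `L(1)/Ω = #Ш·Tam/#W'(ℚ)²`
  obtain ⟨hfinpt, hfin, hq⟩ := twin_centralValue_eq_of_hasCM hBF hmod W' hcm hL
  haveI := hfinpt; haveI := hfin
  ------------------------------------------------------------------ the three arithmetic factors
  have htam : W'.tamagawaProduct = 8 :=
    tamagawaProduct_eq_eight_of_smul_eq_cm7_quadraticTwist_splitPrime hl hl4
      (by rw [← legendreSym_neg_seven_eq_jacobiSym hl2]; exact hl7) W' C hC
  have hcard : Nat.card W'.toAffine.Point = 2 := by
    rw [← torsionOrder_eq_natCard_of_finite]; exact torsionOrder_eq_two_of_j_eq W' (Or.inl hj)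
  have hsha : padicValNat 2 W'.shaOrder = 0 := padicValNat_two_shaOrder_posTwist_of_symbol_neg_pOne hl8 hl7 hσ W' C hC'
  have hS0 : W'.shaOrder ≠ 0 := (Nat.card_pos (α := W'.sha)).ne'
  ------------------------------------------------------------------ the witness `q = twinQuotient W' = 2·#Ш`
  have hΩ : CoatesLiTianZhai2015.leastRealPeriod W' = W'.realPeriodRat :=
    leastRealPeriod_eq_realPeriodRat_of_smul_eq_cm7_quadraticTwist W' hl0 ⟨C, hC⟩
  have hΩ0 : (W'.realPeriodRat : ℂ) ≠ 0 := by exact_mod_cast (W'.realPeriodRat_pos_holds).ne'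
  have htq : twinQuotient W' = 2 * (W'.shaOrder : ℚ) := by
    unfold twinQuotient; rw [htam, hcard]; push_cast; ring
  refine ⟨twinQuotient W', ?_, ?_, ?_⟩
  · rw [hΩ]; push_cast
    rw [← hq]; field_simp
  · rw [htq]; exact mul_ne_zero two_ne_zero (by exact_mod_cast hS0)
  · rw [htq, padicValRat.mul two_ne_zero (by exact_mod_cast hS0), padicValRat.of_nat, hsha,
      show padicValRat 2 (2 : ℚ) = 1 by simpa using padicValRat.self (p := 2) one_lt_two]
    norm_num

end PartnerLValuePOne

/-! ## §2 The type-α form (C7A's χ_p / χ_e package input) -/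

section Alpha
variable {p : ℕ} [Fact p.Prime]

/-- **`L(49a1^{(p)}, 1)·√p = r·Ω(49a1)`, `r ≠ 0`, `ord₂ r = 1`, on type α at `p ≡ 1 (mod 8)`** — the twin of `lValue_posTwist_mul_sqrt_of_alpha`
(`…TwinQuarterTracePartnerPAlphaHeight`, `p ≡ 5 (8)`): §1 in the symbol form supplied by c301's `symbolNeg_iff_not_exists_pow_four`, and the period law
`√p·Ω(W_p) = Ω(49a1)` (Pal). [cite: BurungaleTian2026, Thm. 1.1] [cite: BurungaleFlach2024, Cor. 2] [cite: Pal2012, Thm. 3.2 (case d > 0)] -/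
theorem lValue_posTwist_mul_sqrt_of_alpha_pOne (hBT : burungaleTian_analyticRank_eq_zero_of_selmerCorank_eq_zero_of_hasCM)
    (hBF : bsdTriple_of_hasCM_of_L_one_ne_zero) (hnew : exists_isNewformOf) (hp8 : p % 8 = 1) (hp7 : legendreSym p (-7) = 1)
    (hα : ¬ ∃ x : ZMod p, x ^ 4 = -7) (Wp : WeierstrassCurve ℚ) [Wp.IsElliptic] [Wp.IsGloballyMinimal]
    (hC : ∃ C : VariableChange ℚ, C • Wp = cm7.quadraticTwist (p : ℚ)) :
    ∃ r : ℚ, r ≠ 0 ∧ padicValRat 2 r = 1 ∧ Wp.entireLFunction 1 * (Real.sqrt p : ℂ) = ((r : ℝ) * cm7.realPeriodRat : ℝ) := by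
  have hp : p.Prime := Fact.out
  have hp4 : p % 4 = 1 := by omega
  have hp0 : (p : ℚ) ≠ 0 := by exact_mod_cast hp.ne_zero
  have hσ : ∀ s : ZMod p, s ^ 2 = -7 → ¬ IsSquare (2 * (s - 21)) := (symbolNeg_iff_not_exists_pow_four hp4).mpr hα
  obtain ⟨r, hL, hr0, hv⟩ := exists_LAlg_posTwist_of_symbol_neg_pOne hBT hBF hnew hp8 hp7 hσ Wp hC
  refine ⟨r, hr0, hv, ?_⟩
  rw [hL, leastRealPeriod_eq_realPeriodRat_of_smul_eq_cm7_quadraticTwist Wp hp0 hC,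
    ← sqrt_mul_realPeriodRat_eq_of_smul_eq_cm7_quadraticTwist Wp hp hp4 hC]
  push_cast
  ring

end Alpha

end Summit.BirchSwinnertonDyer.BirchSwinnertonDyer.Theorems.GoldfeldGoodTwists
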